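import Summits.ABC.IUTFork.Joshi.PrototypeWittModel
import Summits.ABC.IUTFork.Joshi.TeichmullerInvariantSurjection
import Literature.NumberTheory.Transcendental.PadicLogPrincipalUnits
import HarnessLib

/-!
# W6, part 3 — two inhabitants of `ClassLift` (E-t52's torsion-invariant surjection `Model.invLift`, every `p`; an EXPLICIT one from
# the Iwasawa logarithm of `ℚ̄_p`, `p ≥ 3`) and W6 NON-VACUITY packaged for EVERY prime `p`: `EtaPtTeich` ∧ bijective `ϕ` ∧
# `ϕ([a]) = [a^p]` ∧ §10.13 transports at every classical point — ONE datum of E-t3's signature, unconditionally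

Test-side support file of the abc-iut cell, block E «type Joshi's construction, test vs S» (rung LADDER-ABC:A2.E; seat abc-iut-E-t50 gen 5;
W6 of abc-iut-E-cx-2's VACUITY column; parts 1–2 = `Joshi/PrototypeWittModelValues.lean`, `Joshi/PrototypeWittModel.lean`). Supplies an
inhabitant of part 1's input structure `ClassLift p` — a norm-preserving surjection on the classes `Q̄_p/∼` — in TWO ways: (i) from
abc-iut-E-t52 g4's SUPPLY file `Joshi/TeichmullerInvariantSurjection.lean` (p451035: `Model.invLift`, torsion-invariant, norm-preserving,
onto, by a cardinality argument — EVERY prime `p`; that file also proves the NECESSITY of such a datum over the signature,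
`PeriodRingDatum.eta_teich_mul_eq_of_transports`: under the Witt law and transports along the forward orbit, `η_y ∘ [·]` is
`μ_{p^∞}`-invariant), giving `invClassLift`; (ii) WITHOUT cardinal arithmetic, from the tree's Iwasawa logarithm `Literature.NumberTheory.Transcendental.padicLogAlgCl` (PadicLogAlgCl / PadicLogAlgClProofs:
`IwasawaLog.log_mul`, `padicLogAlgCl_isIwasawaLog_holds`, `IwasawaLog.hasSum_logSeries_coe`) and the `ℓ`-adic exponential on complete
`ℚ_ℓ`-algebra fields (`PadicExp.plog_exp`, `norm_exp_sub_one_of_norm_le`, closed ball, `ℓ ≥ 3`) — hence the restriction `p ≥ 3` of this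
inhabitant `logClassLift`. TAKES NO SIDE on [IUTchIII] Cor. 3.12,
on Joshi's claims, or on Mochizuki's reports on them; no FACT-LIST row; nothing about print asserted — arithmetic of `ℚ̄_p` and model
bookkeeping only; a model exhibits satisfiability of TYPED hypotheses, nothing more. [folklore]

WHAT IS PROVED.
* §1 `exists_principalUnit_log_eq` (`p ≥ 3`, `‖a‖ ≤ p⁻¹`): `∃ y, ‖1 − y‖ < 1 ∧ log y = a` — `y := exp a` computed in the COMPLETE finite
  subextension `ℚ_p(a) ⊂ ℚ̄_p` (Mathlib `IntermediateField.adjoin`, `FiniteDimensional.complete`), where `plog ∘ exp = id` on the closed ball,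
  read back in `ℚ̄_p` by uniqueness of sums; `exists_norm_one_log_eq` (`p ≥ 3`): EVERY `a ∈ ℚ̄_p` is `log y` with `‖y‖ = 1` (shrink by `p^k`,
  take a `p^k`-th root — `ℚ̄_p` is algebraically closed); `log_eq_of_rel`: `log` is constant on the classes of `∼`.
* §2 `logLift c := N(‖c‖) · υ(log c)` (`N(t)` a chosen element of norm `t`, `υ(a) := a/N(‖a‖)` the «direction» of `a`): `‖logLift c‖ = ‖c‖`,
  constant on classes, and ONTO `ℚ̄_p` (`logLift_surjective`: aim `log` at a small element of the wanted direction); hence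
  **`logClassLift p hp3 : ClassLift p`**.
* §3 `invClassLift` (E-t52's `invLift` read on classes) and **`w6_nonvacuous_all`** (EVERY prime `p`); **`w6_nonvacuous`** (`p ≥ 3`, via the
  explicit `logClassLift`) / **`w6_nonvacuous_three`**: `∃ D : PrototypeDatum …, D.EtaPtTeich ∧ Bijective D.frobY ∧
  (∀ a, D.frob (D.teich a) = D.teich (a ^ D.p)) ∧ (∀ w ∈ D.classicalPts, Nonempty (D.FrobeniusTransport w)) ∧ IsEmpty (D.FrobeniusTransport
  (D.pt 1)) ∧ D.LiftCosetsNotFrobStable` — part 2's `w6_package` at `logClassLift`. With p447117 this CLOSES the W5/W6 cell of the column: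
  «transports everywhere ∧ Witt law» impossible over the signature; «transports on print's locus ∧ Witt law ∧ EtaPtTeich ∧ bijective ϕ»
  jointly consistent (two independent suppliers of the one external choice).
* §4 Cross-check with p451035 §1 (E-t52's NECESSITY theorem `PeriodRingDatum.eta_teich_mul_eq_of_transports`): at the W6 datum the whole
  forward `ϕ`-orbit of a classical class carries transports (`forward_orbit_transports`), so his theorem APPLIES there and yields
  `η_w([ζ·x]) = η_w([x])` for `ζ ∈ μ_{p^∞}` (`eta_teich_torsion_invariant`) — the signature-level necessity and the model agree.
-/

noncomputable section

open Function Set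
open scoped Classical
open Literature.NumberTheory.Transcendental

namespace Summit.ABC.IUTFork.Joshi.JointModel.Witt

/-! ## 1. The Iwasawa logarithm of `ℚ̄_p` (tree: `padicLogAlgCl`, PadicLogAlgClProofs) hits every sufficiently small element from the
principal units, and EVERY element from the unit sphere -/

section LogToolkit

variable (p : ℕ) [hp : Fact p.Prime]

/-- `(p : Q̄_p) ≠ 0`. [folklore] -/
private theorem p_ne_zero' : (p : PadicAlgCl p) ≠ 0 := by exact_mod_cast hp.out.ne_zero

/-- **Small elements are logarithms of principal units** (`p ≥ 3`): for `‖a‖ ≤ p⁻¹` there is `y` with `‖1 − y‖ < 1` and `log y = a` —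
`y := exp a` computed in the COMPLETE subfield `ℚ_p(a)` (Literature `PadicExp.plog_exp` on the closed ball, `p ≥ 3`), read back in `ℚ̄_p`
through `IwasawaLog.hasSum_logSeries_coe`. [folklore] -/
theorem exists_principalUnit_log_eq (hp3 : 3 ≤ p) {a : PadicAlgCl p} (ha : ‖a‖ ≤ (p : ℝ)⁻¹) :
    ∃ y : PadicAlgCl p, ‖1 - y‖ < 1 ∧ padicLogAlgCl p y = a := by
  set K : IntermediateField ℚ_[p] (PadicAlgCl p) := IntermediateField.adjoin ℚ_[p] {a} with hK
  haveI : FiniteDimensional ℚ_[p] K :=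
    IntermediateField.adjoin.finiteDimensional (Algebra.IsAlgebraic.isAlgebraic a).isIntegral
  haveI : IsUltrametricDist K := IsUltrametricDist.of_normedAlgebra ℚ_[p]
  haveI : CompleteSpace K := FiniteDimensional.complete ℚ_[p] K
  have hpK : ‖(p : K)‖ < 1 := IwasawaLog.norm_prime_lt_one (p := p)
  have hp0 : (p : K) ≠ 0 := by exact_mod_cast hp.out.ne_zero
  letI : NontriviallyNormedField K := NontriviallyNormedField.ofNormNeOne ⟨(p : K), hp0, hpK.ne⟩
  let A : K := ⟨a, IntermediateField.mem_adjoin_simple_self ℚ_[p] a⟩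
  have hA : ‖A‖ ≤ (p : ℝ)⁻¹ := ha
  have hlog : PadicExp.plog (NormedSpace.exp A) = A := PadicExp.plog_exp (ℓ := p) hp3 hA
  have hn : ‖NormedSpace.exp A - 1‖ = ‖A‖ := PadicExp.norm_exp_sub_one_of_norm_le (ℓ := p) hp3 hA
  have hy : ‖1 - ((NormedSpace.exp A : K) : PadicAlgCl p)‖ < 1 := by
    have : ‖(1 : K) - NormedSpace.exp A‖ < 1 := by
      rw [norm_sub_rev, hn]
      exact hA.trans_lt (inv_lt_one_of_one_lt₀ (by exact_mod_cast hp.out.one_lt))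
    exact this
  refine ⟨((NormedSpace.exp A : K) : PadicAlgCl p), hy, ?_⟩
  rw [(IwasawaLog.hasSum_log hy).unique (IwasawaLog.hasSum_logSeries_coe K (NormedSpace.exp A) hy)]
  show ((PadicExp.plog (NormedSpace.exp A) : K) : PadicAlgCl p) = a
  rw [hlog]

/-- **Every element of `ℚ̄_p` is the logarithm of an element of norm `1`** (`p ≥ 3`): shrink `a` by `p^k` into the ball, take the principal
unit `y₂` with `log y₂ = p^k a`, and a `p^k`-th root `y` of `y₂` (`ℚ̄_p` is algebraically closed): `p^k log y = log y₂`. [folklore] -/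
theorem exists_norm_one_log_eq (hp3 : 3 ≤ p) (a : PadicAlgCl p) : ∃ y : PadicAlgCl p, ‖y‖ = 1 ∧ padicLogAlgCl p y = a := by
  by_cases ha0 : a = 0
  · exact ⟨1, norm_one, by rw [ha0]; exact (padicLogAlgCl_isIwasawaLog_holds p).log_one⟩
  have hnp : ‖(p : PadicAlgCl p)‖ < 1 := IwasawaLog.norm_prime_lt_one (p := p)
  have hpos : 0 < (p : ℝ)⁻¹ / ‖a‖ := div_pos (inv_pos.2 (by exact_mod_cast hp.out.pos)) (norm_pos_iff.2 ha0)
  obtain ⟨k, hk⟩ := exists_pow_lt_of_lt_one hpos hnp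
  have hsmall : ‖(p : PadicAlgCl p) ^ k * a‖ ≤ (p : ℝ)⁻¹ := by
    rw [norm_mul, norm_pow]
    exact ((lt_div_iff₀ (norm_pos_iff.2 ha0)).1 hk).le
  obtain ⟨y₂, hy₂, hlog₂⟩ := exists_principalUnit_log_eq p hp3 hsmall
  have hy₂1 : ‖y₂‖ = 1 := IwasawaLog.norm_eq_one_of_norm_one_sub_lt hy₂
  obtain ⟨y, hy⟩ := IsAlgClosed.exists_pow_nat_eq y₂ (pow_pos hp.out.pos k)
  have hy1 : ‖y‖ = 1 := by
    have h : ‖y‖ ^ p ^ k = 1 := by rw [← norm_pow, hy, hy₂1]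
    exact (pow_eq_one_iff_of_nonneg (norm_nonneg y) (pow_ne_zero k hp.out.ne_zero)).1 h
  have hy0 : y ≠ 0 := norm_pos_iff.1 (by rw [hy1]; exact one_pos)
  refine ⟨y, hy1, ?_⟩
  have h := (padicLogAlgCl_isIwasawaLog_holds p).log_pow hy0 (p ^ k)
  rw [hy, hlog₂, Nat.cast_pow] at h
  exact (mul_left_cancel₀ (pow_ne_zero k (p_ne_zero' p)) h).symm

/-- `log` is constant on the classes of `∼` (`x^{pⁿ} = y^{pⁿ} ⟹ pⁿ log x = pⁿ log y`; and `x = 0 ⟺ y = 0`). [folklore] -/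
theorem log_eq_of_rel {x y : PadicAlgCl p} (h : Rel p x y) (hx : x ≠ 0) : padicLogAlgCl p x = padicLogAlgCl p y := by
  obtain ⟨n, hn⟩ := h
  have hy : y ≠ 0 := by
    rintro rfl
    rw [zero_pow (pow_ne_zero n hp.out.ne_zero)] at hn
    exact pow_ne_zero _ hx hn
  have h1 := (padicLogAlgCl_isIwasawaLog_holds p).log_pow hx (p ^ n)
  have h2 := (padicLogAlgCl_isIwasawaLog_holds p).log_pow hy (p ^ n)
  rw [hn] at h1
  rw [h1] at h2
  exact mul_left_cancel₀ (by rw [Nat.cast_pow]; exact pow_ne_zero n (p_ne_zero' p)) h2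

/-! ## 2. An EXPLICIT `ClassLift`: `Λ(c) := N(‖c‖) · υ(log c)` — a chosen element of norm `‖c‖` times the «direction» of `log c` -/

/-- A chosen nonzero element of norm `t` (junk `0` if there is none). [folklore] -/
def normRep (t : ℝ) : PadicAlgCl p := if h : ∃ x : PadicAlgCl p, x ≠ 0 ∧ ‖x‖ = t then h.choose else 0

/-- For `x ≠ 0`: `N(‖x‖) ≠ 0` and `‖N(‖x‖)‖ = ‖x‖`. [folklore] -/
theorem normRep_spec {x : PadicAlgCl p} (hx : x ≠ 0) : normRep p ‖x‖ ≠ 0 ∧ ‖normRep p ‖x‖‖ = ‖x‖ := by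
  have h : ∃ x' : PadicAlgCl p, x' ≠ 0 ∧ ‖x'‖ = ‖x‖ := ⟨x, hx, rfl⟩
  unfold normRep
  rw [dif_pos h]
  exact h.choose_spec

/-- The «direction» of `a`: `υ(a) := a / N(‖a‖)` (`1` at `a = 0`), an element of norm `1`. [folklore] -/
def unitDir (a : PadicAlgCl p) : PadicAlgCl p := if a = 0 then 1 else a / normRep p ‖a‖

/-- `‖υ(a)‖ = 1`. [folklore] -/
theorem norm_unitDir (a : PadicAlgCl p) : ‖unitDir p a‖ = 1 := by
  unfold unitDir
  split_ifs with h
  · exact norm_one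
  · rw [norm_div, (normRep_spec p h).2, div_self (norm_ne_zero_iff.2 h)]

/-- **The log-lift** `Λ₀(c) := N(‖c‖) · υ(log c)` (`0` at `c = 0`). [folklore] -/
def logLift (c : PadicAlgCl p) : PadicAlgCl p := if c = 0 then 0 else normRep p ‖c‖ * unitDir p (padicLogAlgCl p c)

/-- `‖Λ₀(c)‖ = ‖c‖`. [folklore] -/
theorem norm_logLift (c : PadicAlgCl p) : ‖logLift p c‖ = ‖c‖ := by
  unfold logLift
  split_ifs with h
  · rw [h, norm_zero]
  · rw [norm_mul, (normRep_spec p h).2, norm_unitDir, mul_one]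

/-- `Λ₀` is constant on the classes of `∼` (norm and logarithm are). [folklore] -/
theorem logLift_eq_of_rel {x y : PadicAlgCl p} (h : Rel p x y) : logLift p x = logLift p y := by
  by_cases hx : x = 0
  · obtain ⟨n, hn⟩ := h
    have hy : y = 0 := by
      rw [hx, zero_pow (pow_ne_zero n hp.out.ne_zero)] at hn
      exact pow_eq_zero_iff (pow_ne_zero n hp.out.ne_zero) |>.1 hn.symm
    rw [hx, hy]
  · have hy : y ≠ 0 := by
      obtain ⟨n, hn⟩ := h
      rintro rfl
      rw [zero_pow (pow_ne_zero n hp.out.ne_zero)] at hn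
      exact pow_ne_zero _ hx hn
    unfold logLift
    rw [if_neg hx, if_neg hy, norm_eq_of_rel p h, log_eq_of_rel p h hx]

/-- **`Λ₀` is ONTO `ℚ̄_p`** (`p ≥ 3`): for `ξ ≠ 0`, aim the logarithm at `a := (ξ/N(‖ξ‖)) · N(‖p²‖)` (norm `p⁻² ≤ p⁻¹`, direction
`ξ/N(‖ξ‖)`) with `c := ξ · y`, `‖y‖ = 1`, `log y = a − log ξ`. [folklore] -/
theorem logLift_surjective (hp3 : 3 ≤ p) : Surjective (logLift p) := by
  intro ξ
  by_cases hξ : ξ = 0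
  · exact ⟨0, by rw [hξ]; unfold logLift; rw [if_pos rfl]⟩
  obtain ⟨hν0, hν⟩ := normRep_spec p hξ
  have hp2 : ((p : PadicAlgCl p) ^ 2) ≠ 0 := pow_ne_zero 2 (p_ne_zero' p)
  obtain ⟨hr0, hr⟩ := normRep_spec p hp2
  set u₀ : PadicAlgCl p := ξ / normRep p ‖ξ‖ with hu₀
  set a : PadicAlgCl p := u₀ * normRep p ‖(p : PadicAlgCl p) ^ 2‖ with ha
  have hu₀n : ‖u₀‖ = 1 := by rw [hu₀, norm_div, hν, div_self (norm_ne_zero_iff.2 hξ)]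
  have han : ‖a‖ = ‖(p : PadicAlgCl p) ^ 2‖ := by rw [ha, norm_mul, hu₀n, one_mul, hr]
  have ha0 : a ≠ 0 := by
    rw [← norm_pos_iff, han, norm_pos_iff]; exact hp2
  obtain ⟨y, hy1, hlogy⟩ := exists_norm_one_log_eq p hp3 (a - padicLogAlgCl p ξ)
  have hy0 : y ≠ 0 := norm_pos_iff.1 (by rw [hy1]; exact one_pos)
  refine ⟨ξ * y, ?_⟩
  have hc0 : ξ * y ≠ 0 := mul_ne_zero hξ hy0
  have hcn : ‖ξ * y‖ = ‖ξ‖ := by rw [norm_mul, hy1, mul_one]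
  have hlogc : padicLogAlgCl p (ξ * y) = a := by rw [IwasawaLog.log_mul hξ hy0, hlogy]; ring
  unfold logLift
  rw [if_neg hc0, hcn, hlogc]
  unfold unitDir
  rw [if_neg ha0, han, ha, mul_div_cancel_right₀ _ hr0, hu₀, mul_div_cancel₀ _ hν0]

/-- **The explicit class-lift from the Iwasawa logarithm** (`p ≥ 3`): `Λ(w) := Λ₀(w.out)`. [folklore] -/
def logClassLift (hp3 : 3 ≤ p) : ClassLift p where
  toFun w := logLift p w.out
  norm_apply w := norm_logLift p _
  surjective ξ := by
    obtain ⟨c, hc⟩ := logLift_surjective p hp3 ξ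
    exact ⟨mk p c, by show logLift p (mk p c).out = ξ; rw [logLift_eq_of_rel p (rel_out_mk p c), hc]⟩

end LogToolkit

/-! ## 3. W6 NON-VACUITY — for EVERY prime via E-t52's `invLift`, and via the explicit log-lift for `p ≥ 3` -/

section InvLift

variable (p : ℕ) [hp : Fact p.Prime]

/-- **E-t52 g4's torsion-invariant surjection, read on classes**: `Λ(w) := invLift (w.out)` (p451035 `Model.invLift`, `norm_invLift`,
`invLift_surjective`, `invLift_eq_of_pow_prime_pow_eq` — constant on the classes of `∼`). [folklore] -/
def invClassLift : ClassLift p where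
  toFun w := Model.invLift p w.out
  norm_apply w := Model.norm_invLift p _
  surjective ξ := by
    obtain ⟨c, hc⟩ := Model.invLift_surjective p ξ
    obtain ⟨n, hn⟩ := rel_out_mk p c
    exact ⟨mk p c, by show Model.invLift p (mk p c).out = ξ; rw [Model.invLift_eq_of_pow_prime_pow_eq p hn, hc]⟩

/-- **W6 (packaged, ∃-form) for EVERY prime `p`**, at part 2's datum instantiated with E-t52's class-lift. [folklore] -/
theorem w6_nonvacuous_all :
    ∃ D : PrototypeDatum (PadicAlgCl p) (Ring p) (PadicAlgCl p) (Pt p) (fun _ => PadicAlgCl p) Unit,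
      D.EtaPtTeich ∧ Bijective D.frobY ∧ (∀ a, D.frob (D.teich a) = D.teich (a ^ D.p)) ∧
        (∀ w ∈ D.classicalPts, Nonempty (D.FrobeniusTransport w)) ∧ IsEmpty (D.FrobeniusTransport (D.pt 1)) ∧
        D.LiftCosetsNotFrobStable :=
  ⟨prototypeDatum (invClassLift p), w6_package _⟩

end InvLift


/-- **W6 (packaged, ∃-form).** For every prime `p ≥ 3` there is ONE datum of E-t3's signature carrying: E-t2's `EtaPtTeich` ∧ a BIJECTIVE
point-Frobenius ∧ the Witt–Teichmüller law `ϕ([a]) = [a^p]` ∧ a §10.13 `FrobeniusTransport` at EVERY classical point ∧ NONE at the junk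
fixed point `pt 1` ∧ Rmk. 7.4.3's `LiftCosetsNotFrobStable`. A model exhibits joint satisfiability of TYPED hypotheses, nothing more. [folklore] -/
theorem w6_nonvacuous (p : ℕ) [Fact p.Prime] (hp3 : 3 ≤ p) :
    ∃ D : PrototypeDatum (PadicAlgCl p) (Ring p) (PadicAlgCl p) (Pt p) (fun _ => PadicAlgCl p) Unit,
      D.EtaPtTeich ∧ Bijective D.frobY ∧ (∀ a, D.frob (D.teich a) = D.teich (a ^ D.p)) ∧
        (∀ w ∈ D.classicalPts, Nonempty (D.FrobeniusTransport w)) ∧ IsEmpty (D.FrobeniusTransport (D.pt 1)) ∧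
        D.LiftCosetsNotFrobStable :=
  ⟨prototypeDatum (logClassLift p hp3), w6_package _⟩

/-- … in particular at `p = 3`. [folklore] -/
theorem w6_nonvacuous_three :
    ∃ D : PrototypeDatum (PadicAlgCl 3) (Ring 3) (PadicAlgCl 3) (Pt 3) (fun _ => PadicAlgCl 3) Unit,
      D.EtaPtTeich ∧ Bijective D.frobY ∧ (∀ a, D.frob (D.teich a) = D.teich (a ^ D.p)) ∧
        (∀ w ∈ D.classicalPts, Nonempty (D.FrobeniusTransport w)) ∧ IsEmpty (D.FrobeniusTransport (D.pt 1)) ∧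
        D.LiftCosetsNotFrobStable :=
  w6_nonvacuous 3 le_rfl


/-! ## 4. Cross-check with E-t52's NECESSITY theorem (p451035 §1): its antecedent is INHABITED at the W6 datum -/

section Necessity

variable {p : ℕ} [hp : Fact p.Prime] (Λ : ClassLift p)

/-- Forward `ϕ`-iterates of a classical class are classical (`e(ϕ w) = p·e(w) > 0`). [folklore] -/
theorem e_iterate_pos {w : Pt p} (hw : 0 < e p w) (i : ℕ) : 0 < e p ((prototypeDatum Λ).frobY^[i] w) := by
  induction i with
  | zero => exact hw
  | succ i ih =>
    rw [Function.iterate_succ_apply']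
    show 0 < e p (frobPt p _)
    rw [Induced.e_frobPt]
    exact mul_pos (Nat.cast_pos.2 hp.out.pos) ih

/-- **The whole forward orbit of a classical class carries §10.13 transports** at the W6 datum — the antecedent of E-t52's
`PeriodRingDatum.eta_teich_mul_eq_of_transports`. [folklore] -/
theorem forward_orbit_transports {w : Pt p} (hw : 0 < e p w) (i : ℕ) :
    Nonempty ((prototypeDatum Λ).FrobeniusTransport ((prototypeDatum Λ).frobY^[i] w)) :=
  ⟨transport Λ (e_iterate_pos Λ hw i)⟩

/-- Hence E-t52's necessity conclusion holds at the W6 datum BY HIS THEOREM (not only by construction): `η_w([ζ·x]) = η_w([x])` for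
`ζ ∈ μ_{p^∞}` at every classical class — the signature-level necessity and the model's class-factorisation agree. [folklore] -/
theorem eta_teich_torsion_invariant {w : Pt p} (hw : 0 < e p w) (k : ℕ) {ζ : PadicAlgCl p}
    (hζ : ζ ^ (prototypeDatum Λ).p ^ k = 1) (x : PadicAlgCl p) :
    (prototypeDatum Λ).eta w ((prototypeDatum Λ).teich (ζ * x)) = (prototypeDatum Λ).eta w ((prototypeDatum Λ).teich x) :=
  (prototypeDatum Λ).eta_teich_mul_eq_of_transports (frob_teich Λ) k (forward_orbit_transports Λ hw) hζ x

end Necessity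

end Summit.ABC.IUTFork.Joshi.JointModel.Witt

end
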